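import Literature.NumberTheory.Automorphic.ReductiveDual
import Literature.NumberTheory.Automorphic.RootDataRootsFiniteProofs
import Literature.NumberTheory.Automorphic.RootSubgroupProofs
import Literature.NumberTheory.Automorphic.TorusCharacters
import HarnessLib

/-!
# The root datum of a connected reductive group: reduction of `Literature.NumberTheory.Automorphic.exists_isRootDatumOf`

Trunk T-AUTOMORPHIC (G25 AutomorphicL), proof file for
`Literature.NumberTheory.Automorphic.ReductiveDual`, item (b). The named fact
`Literature.NumberTheory.Automorphic.exists_isRootDatumOf` (**lang.S13** (b); Springer, *Linear Algebraic Groups*, 2nd ed.,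
7.4.3 with 8.1.1–8.1.4: a connected reductive group `G` over an algebraically closed field, with
a maximal torus `T`, *has* a reduced root datum `Ψ(G, T) = (X*(T), R, X_*(T), R^∨)`, packaged as a
Mathlib `RootPairing ι ℤ X Y` that `IsRootDatumOf G T`) rests on the whole structure theory of
chapters 3–8 of Springer's book (tori and their character groups, Lie algebras and weights, Borel
subgroups, the Weyl group, the classification of semisimple groups of rank one), none of which
exists yet for the concrete `Subgroup (GL n k)` vocabulary of `LinearAlgebraicGroups.lean` /
`RootData.lean`. Following the architecture of the printed proof of 7.4.3, this file separates the
group-theoretic inputs (named facts, `def … : Prop`, each with Springer's numbering) from the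
combinatorial assembly (proved). Part I:

* theorem of the tree (`TorusCharacters.lean`, `exists_dualBases_of_isTorusSubgroup`; Springer
  3.2.7 (iii), 3.2.11 (i), proved by reduction to `T ≤ 𝔻ₙ`, 3.2.2–3.2.3, 3.2.10): for a torus
  `T` the character and cocharacter groups `X*(T)`, `X_*(T)` are free abelian of the same finite
  rank `r` and `⟨χ, λ⟩` (`χ (λ a) = a ^ ⟨χ, λ⟩`, `charPairingInt`) is a perfect pairing — in
  coordinates: there are group isomorphisms `X*(T) ≃ ℤʳ`, `X_*(T) ≃ ℤʳ` carrying `⟨ , ⟩` to the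
  standard pairing (dual bases).
* `exists_corootMap` (the named fact of this file; Springer 7.4.3 with 7.3.5 (i), 8.1.1 (i),
  8.1.4 (i)): for `G` connected reductive and `T` a maximal torus there is a coroot map
  `α ↦ α^∨`, `R → X_*(T)`, such that (a) every triple `(u_α, u_{-α}, α^∨)` is realised by an
  algebraic homomorphism `SL₂ → G` (`IsSL2Realization`; 8.1.1 (i), 8.1.4 (i) and formula (22),
  whose proof reduces to `SL₂` through `SL₂ → (G_α, G_α)`, 7.2.4, 7.3.5), and (b) axiom (RD 2)
  of 7.4.1 holds:
  `s_α(R) ⊆ R` and `s_α^∨(R^∨) ⊆ R^∨` (7.4.3, via 7.1.8 (i) and 7.1.4).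
* theorems/facts of the tree: `roots_finite_holds` (`RootDataRootsFiniteProofs.lean`; `R` is
  finite, 7.4.3 with 7.1.1, 8.1.1–8.1.2) and the named fact `roots_isReduced`
  (`RootDataProofs.lean`; Springer 7.4.4) with its proved assembly
  `isReduced_of_isRootDatumOf_of_roots_isReduced`.

Proved in Part I (sorry-free):

* `IsSL2Realization.comp_eq_zpowGroupHom_two`, `IsSL2Realization.charPairingInt_eq_two`:
  axiom (RD 1) `⟨α, α^∨⟩ = 2` *follows* from an `SL₂`-realisation (conjugate `u_α` by
  `α^∨(s) = φ(diag(s, s⁻¹))` inside `SL₂`; root homomorphisms are injective, `IsRootHom.injective`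
  of `RootSubgroupProofs.lean`; characters of `𝔾ₘ` over an infinite field are distinct,
  `zpowGroupHom_units_injective`).
* `injective_of_mapsTo_preReflection`: Springer's argument in 7.4.3 that `α ↦ α^∨` is injective,
  which is Mathlib's `Module.eq_of_mapsTo_reflection_of_mem` (if `α^∨ = β^∨` then the roots
  `(s_α s_β)^t β = β + 2t (α - β)` are pairwise distinct unless `α = β`, contradicting the
  finiteness of `R`), repackaged for the indexed families fed to `RootPairing.mk'`.
* `Literature.NumberTheory.Automorphic.exists_isRootDatumOf_of_corootMap`: the assembly
  `exists_corootMap → roots_isReduced → exists_isRootDatumOf`. Transport `R`, `R^∨` to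
  `X = Y = ℤʳ` (the fact asks for types in `Type`), index `R` by `Fin m`, and apply Mathlib's
  `RootPairing.mk'`, which manufactures the reflection permutations and the compatibility
  `(s_α β)^∨ = s_α^∨ (β^∨)` from (RD 1), (RD 2) and finiteness (Mathlib's form of [Bourbaki,
  Lie VI §1.1, Lemme 1]); the fields of `IsRootDatumOf` are then the defining properties of the
  data, and reducedness is `roots_isReduced`.

## Part II — the Weyl elements `n_α` (Springer 8.1.4): coroots and (RD 2) from realisations

The second half of the file reduces `exists_corootMap` to the existence of the realisations
alone, following Springer 8.1.4: the Weyl element `n_α = u_α(1) u_{-α}(-1) u_α(1) = φ_α(w)`,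
`w = (0 1; -1 0)`, normalises `T` and induces `s_α` on `X*(T)` and `s_α^∨` on `X_*(T)`, so that
conjugation by `n_α` carries a realisation of `(β, β^∨)` to one of `(s_α β, s_α^∨ β^∨)`; and the
coroot of a root is unique (rigidity of tori). Everything in Part II is elementary (identities in
`SL₂` and in `G`, Dedekind's independence of characters).

Proved in Part II:

* `unipotentUpperSL2_mul_unipotentLowerSL2_mul_unipotentUpperSL2` (Springer's formula (22) in
  `SL₂`: `u⁺(x) u⁻(-x⁻¹) u⁺(x) = diag(x, x⁻¹) w`), `weylSL2_mul_weylSL2` (`w² = diag(-1, -1)`);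
* bilinearity of `⟨χ, λ⟩` (`charPairingInt_mul_left/right`, `_inv_`, `_zpow_`; 3.2.11 (i));
* `IsSL2Realization.inclusion_mul_weyl_mul_inv` ((22) in `G`: `t n_α t⁻¹ = α^∨(α t) n_α`),
  `IsSL2Realization.weyl_mul_weyl` (`n_α² = α^∨(-1)`, 8.1.4 (ii)),
  `IsSL2Realization.weyl_mul_inclusion_mul_weyl_inv`, `…weyl_inv_mul_inclusion_mul_weyl`
  (**`n_α ∈ N_G(T)`**, acting on `T` by the involution `reflConj α α^∨ : t ↦ t · α^∨(α t)⁻¹`;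
  8.1.4 (i));
* `coe_rootReflection_eq_comp_reflConj`, `coe_corootReflection_eq_reflConj_comp`: this
  involution induces `s_α(χ) = χ - ⟨χ, α^∨⟩ α` on characters and `s_α^∨(λ) = λ - ⟨α, λ⟩ α^∨` on
  cocharacters (7.1.8, 7.3.5);
* `IsRootHom.conj`, `IsAlgebraicSL2Hom.conj`, `IsSL2Realization.reflect`: conjugating by `n_α`
  turns a root homomorphism for `β` into one for `s_α(β)` and a realisation of `(β, β^∨)` into one
  of `(s_α(β), s_α^∨(β^∨))` (8.1.1 with 7.1.4; 7.4.3); `rootReflection_ne_one` (`s_α β ≠ 0`);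
* `finite_setOf_isConjugateChar` (rigidity, 3.2.8–3.2.9, elementary form): an algebraic character
  `χ` of any `T ≤ GL n` has only finitely many conjugates `t ↦ χ(h t h⁻¹)`, `h` normalising `T`
  (they are polynomials of bounded degree in the coordinates, and distinct characters are
  linearly independent — Dedekind, Mathlib `linearIndependent_monoidHom`);
* `IsSL2Realization.coroot_eq` (**the coroot of a root is unique**; 7.1.8 with 7.3.4–7.3.5,
  8.1.4): for a torus `T` in any `G`, two realisations of the same root `α ≠ 0` have the same
  coroot — `g = n_α n'_α` acts on `X*(T)` by the transvection `χ ↦ χ + ⟨χ, α^∨ - α'^∨⟩ α`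
  (`rootReflection_rootReflection_eq`), its powers give infinitely many conjugates of `χ`
  unless `⟨χ, α^∨ - α'^∨⟩ = 0` (`X*(T)` is torsion-free), and characters separate cocharacters
  (dual bases, `TorusCharacters.lean`);
* `exists_corootMap_of_sl2Realization`: **`exists_sl2Realization → exists_corootMap`** (choose
  realisations; (RD 2) by reflecting them, the coroot half through the uniqueness of the coroot
  of the root `s_α β`), and `Literature.NumberTheory.Automorphic.exists_isRootDatumOf_of_sl2Realization`:
  **`exists_sl2Realization → roots_isReduced → exists_isRootDatumOf`**.

Named fact of Part II (the remaining input, `def … : Prop`):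

* `exists_sl2Realization` (8.1.4 (i) with 7.2.4, 7.3.3–7.3.5, 8.1.1 (i)): every root of a
  connected reductive `G` relative to a maximal torus `T` admits an `SL₂`-realisation — the
  structure theory proper (centralisers of singular tori are connected reductive of semisimple
  rank one, 7.1.3, 7.6.4 (i), and those have derived group `SL₂` or `PSL₂`, 7.2.4, 7.3.2).

Remaining DAG for `exists_isRootDatumOf_holds` (closed form): discharge `exists_sl2Realization`
(8.1.4 (i) with 7.1.3, 7.6.4 (i), 7.2.4, 7.3.2–7.3.5) and `roots_isReduced` (7.4.4), i.e. the
deep part of the structure theory of reductive groups (Lie algebras of closed subgroups of `GL n`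
and weights, Borel subgroups, centralisers of singular tori, connected reductive groups of
semisimple rank one); see also the named facts of `RootSubgroupProofs.lean`.

## References

* T. A. Springer, *Linear Algebraic Groups*, 2nd ed., Progress in Mathematics 9, Birkhäuser
  (1998), 3.2.2, 3.2.7–3.2.9, 3.2.11, 7.1.3, 7.1.4, 7.1.8, 7.2.2, 7.2.4, 7.3.2–7.3.5, 7.4.1,
  7.4.3, 7.4.4, 7.6.4, 8.1.1, 8.1.4.
* N. Bourbaki, *Groupes et algèbres de Lie*, Ch. VI, §1.1.
-/

open scoped IsMulCommutative MatrixGroups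

noncomputable section

namespace Literature.NumberTheory.Automorphic

variable {k : Type*} [Field k] {n : Type*} [Fintype n] [DecidableEq n]

/-! ### Conjugation of the unipotent one-parameter subgroups of `SL₂` by its diagonal torus -/

section SL2

/-- In `SL₂`: `diag(s, s⁻¹) · (1 x; 0 1) · diag(s, s⁻¹)⁻¹ = (1 s²x; 0 1)`, i.e. the diagonal torus
acts on the upper root subgroup through the character `s ↦ s²` (Springer 7.3.6, 8.1.4:
`α(diag(x, x⁻¹)) = x²`). [cite: SpringerLAG1998, 8.1.4 (proof)] -/
theorem diagSL2_mul_unipotentUpperSL2_mul_inv (s : kˣ) (x : k) :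
    diagSL2 s * unipotentUpperSL2 (Multiplicative.ofAdd x) * (diagSL2 s)⁻¹ =
      unipotentUpperSL2 (R := k) (Multiplicative.ofAdd ((s : k) * s * x)) := by
  rw [← map_inv]
  refine Subtype.ext ?_
  simp only [Matrix.SpecialLinearGroup.coe_mul, coe_diagSL2, coe_unipotentUpperSL2, toAdd_ofAdd,
    Matrix.mul_fin_two, inv_inv, Units.inv_mul, Units.mul_inv, mul_one, mul_zero, zero_mul,
    add_zero, zero_add, mul_right_comm _ x]

/-- In `SL₂`: `diag(s, s⁻¹) · (1 0; x 1) · diag(s, s⁻¹)⁻¹ = (1 0; s⁻²x 1)`, i.e. the diagonal torus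
acts on the lower root subgroup through the character `s ↦ s⁻²` (Springer 8.1.4, `u_{-α}`).
[cite: SpringerLAG1998, 8.1.4 (proof)] -/
theorem diagSL2_mul_unipotentLowerSL2_mul_inv (s : kˣ) (x : k) :
    diagSL2 s * unipotentLowerSL2 (Multiplicative.ofAdd x) * (diagSL2 s)⁻¹ =
      unipotentLowerSL2 (R := k) (Multiplicative.ofAdd (((s⁻¹ : kˣ) : k) * (s⁻¹ : kˣ) * x)) := by
  rw [← map_inv]
  refine Subtype.ext ?_
  simp only [Matrix.SpecialLinearGroup.coe_mul, coe_diagSL2, coe_unipotentLowerSL2, toAdd_ofAdd,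
    Matrix.mul_fin_two, inv_inv, Units.inv_mul, Units.mul_inv, mul_one, mul_zero, zero_mul,
    add_zero, zero_add, mul_right_comm _ x]

end SL2

/-! ### The value of the pairing -/

section Pairing

variable {T : Subgroup (GL n k)}

/-- Over an infinite field, if `χ ∘ λ = (· ^ m)` then `⟨χ, λ⟩ = m`: the exponent is unique
(`zpowGroupHom_units_injective`, Springer 3.2.2 with `n = 1`), so the choice in `charPairingInt`
returns it. [cite: SpringerLAG1998, 3.2.11 (i)] -/
theorem charPairingInt_eq_of_comp_eq [Infinite k] {χ : ↥T →* kˣ} {γ : kˣ →* ↥T} {m : ℤ}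
    (h : χ.comp γ = zpowGroupHom m) : charPairingInt χ γ = m := by
  have hex : ∃ m : ℤ, χ.comp γ = zpowGroupHom m := ⟨m, h⟩
  rw [charPairingInt, dif_pos hex]
  exact zpowGroupHom_units_injective (hex.choose_spec.symm.trans h)

end Pairing

/-! ### `SL₂`-realisations of a root and its coroot -/

section SL2Realization

variable (G T : Subgroup (GL n k))

/-- `φ : SL₂ → G` *realises* the root `α` of `(G, T)` with coroot `α^∨ = αv`: `φ` is an algebraic
homomorphism whose restrictions to the upper and lower unipotent subgroups of `SL₂` are root
homomorphisms `u_α`, `u_{-α}` for `α` and `-α` (`IsRootHom`, Springer 8.1.1 (i)) and whose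
restriction to the diagonal torus is the cocharacter `α^∨`, `φ(diag(t, t⁻¹)) = α^∨(t)`. This is
the homomorphism `SL₂ → (G_α, G_α) ≤ G` of Springer 8.1.4 (proof) — an isomorphism onto
`(G_α, G_α) ≅ SL₂` or the isogeny onto `(G_α, G_α) ≅ PSL₂` of 7.2.4 — for a realisation
`(u_α)` in the sense of 8.1.4 (i); by formula (22) there, `u_α(x) u_{-α}(-x⁻¹) u_α(x) = α^∨(x) n_α`,
it determines the coroot (7.3.5 (i)). It is exactly the datum demanded, root by root, by
`IsRootDatumOf.exists_sl2Hom`. [cite: SpringerLAG1998, 8.1.4 (i) and (22), with 7.2.4, 7.3.5 (i)] -/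
def IsSL2Realization (hTG : T ≤ G) (α : ↥T →* kˣ) (αv : kˣ →* ↥T) (φ : SL(2, k) →* ↥G) :
    Prop :=
  IsAlgebraicSL2Hom φ ∧ IsRootHom G T hTG α (φ.comp unipotentUpperSL2) ∧
    IsRootHom G T hTG α⁻¹ (φ.comp unipotentLowerSL2) ∧
    ∀ t : kˣ, φ (diagSL2 t) = Subgroup.inclusion hTG (αv t)

variable {G T}

/-- If `φ : SL₂ → G` realises `(α, α^∨)` then `α ∘ α^∨ = (s ↦ s²)`: conjugating `u_α(1)` by
`α^∨(s) = φ(diag(s, s⁻¹))` gives `u_α(α(α^∨(s))) = φ(diag · (1 1; 0 1) · diag⁻¹) = u_α(s²)`, and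
`u_α` is injective (Springer 7.3.6: `α(diag(x, x⁻¹)) = x²`, `α^∨(x) = diag(x, x⁻¹)`).
[cite: SpringerLAG1998, 7.3.6 and 8.1.4] -/
theorem IsSL2Realization.comp_eq_zpowGroupHom_two {hTG : T ≤ G} {α : ↥T →* kˣ} {αv : kˣ →* ↥T}
    {φ : SL(2, k) →* ↥G} (h : IsSL2Realization G T hTG α αv φ) :
    α.comp αv = zpowGroupHom 2 := by
  obtain ⟨-, hu, -, hdiag⟩ := h
  refine MonoidHom.ext fun s => Units.ext ?_
  have hconj := hu.2.2 (αv s) 1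
  rw [← hdiag s, MonoidHom.comp_apply, ← map_inv, ← map_mul, ← map_mul,
    diagSL2_mul_unipotentUpperSL2_mul_inv] at hconj
  have hinj := hu.injective hconj
  rw [mul_one, mul_one, EmbeddingLike.apply_eq_iff_eq] at hinj
  rw [MonoidHom.comp_apply, zpowGroupHom_apply, zpow_two, Units.val_mul]
  exact hinj.symm

/-- (RD 1) from an `SL₂`-realisation: `⟨α, α^∨⟩ = 2` (Springer 7.4.1 (RD 1), 7.4.3 via 7.1.8 (i);
here over any infinite field). [cite: SpringerLAG1998, 7.4.3 (RD 1)] -/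
theorem IsSL2Realization.charPairingInt_eq_two [Infinite k] {hTG : T ≤ G} {α : ↥T →* kˣ}
    {αv : kˣ →* ↥T} {φ : SL(2, k) →* ↥G} (h : IsSL2Realization G T hTG α αv φ) :
    charPairingInt α αv = 2 :=
  charPairingInt_eq_of_comp_eq h.comp_eq_zpowGroupHom_two

end SL2Realization

/-! ### The reflections `s_α`, `s_α^∨` of Springer 7.4.1, written multiplicatively -/

section Reflections

variable {T : Subgroup (GL n k)} [IsMulCommutative ↥T]

/-- The endomorphism `s_α` of the character group attached to a character `α` and a cocharacter
`α^∨ = αv` (Springer 7.4.1): `s_α(χ) = χ - ⟨χ, α^∨⟩ α`, written multiplicatively in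
`X*(T) ≤ (T →* kˣ)` as `χ · α ^ (-⟨χ, α^∨⟩)`. [cite: SpringerLAG1998, 7.4.1] -/
def rootReflection (α : ↥(characterLattice T)) (αv : ↥(cocharacterLattice T))
    (χ : ↥(characterLattice T)) : ↥(characterLattice T) :=
  χ * (α ^ charPairingInt (χ : ↥T →* kˣ) (αv : kˣ →* ↥T))⁻¹

/-- The endomorphism `s_α^∨` of the cocharacter group attached to `α` and `α^∨ = αv`
(Springer 7.4.1): `s_α^∨(λ) = λ - ⟨α, λ⟩ α^∨`, written multiplicatively in `X_*(T) ≤ (kˣ →* T)`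
as `λ · (α^∨) ^ (-⟨α, λ⟩)`. [cite: SpringerLAG1998, 7.4.1] -/
def corootReflection (α : ↥(characterLattice T)) (αv : ↥(cocharacterLattice T))
    (γ : ↥(cocharacterLattice T)) : ↥(cocharacterLattice T) :=
  γ * (αv ^ charPairingInt (α : ↥T →* kˣ) (γ : kˣ →* ↥T))⁻¹

/-- `s_α` in additive coordinates: a group isomorphism `bX : X*(T) ≃ L` carries `s_α(χ)` to
`bX χ - ⟨χ, α^∨⟩ • bX α`. [cite: SpringerLAG1998, 7.4.1] -/
theorem map_rootReflection {L : Type*} [AddCommGroup L] (bX : Additive ↥(characterLattice T) ≃+ L)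
    (α : ↥(characterLattice T)) (αv : ↥(cocharacterLattice T)) (χ : ↥(characterLattice T)) :
    bX (Additive.ofMul (rootReflection α αv χ)) =
      bX (Additive.ofMul χ) -
        charPairingInt (χ : ↥T →* kˣ) (αv : kˣ →* ↥T) • bX (Additive.ofMul α) := by
  rw [rootReflection, ofMul_mul, ofMul_inv, ofMul_zpow, map_add, map_neg, map_zsmul,
    sub_eq_add_neg]

/-- `s_α^∨` in additive coordinates: a group isomorphism `bY : X_*(T) ≃ L` carries `s_α^∨(λ)` to
`bY λ - ⟨α, λ⟩ • bY α^∨`. [cite: SpringerLAG1998, 7.4.1] -/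
theorem map_corootReflection {L : Type*} [AddCommGroup L]
    (bY : Additive ↥(cocharacterLattice T) ≃+ L) (α : ↥(characterLattice T))
    (αv : ↥(cocharacterLattice T)) (γ : ↥(cocharacterLattice T)) :
    bY (Additive.ofMul (corootReflection α αv γ)) =
      bY (Additive.ofMul γ) -
        charPairingInt (α : ↥T →* kˣ) (γ : kˣ →* ↥T) • bY (Additive.ofMul αv) := by
  rw [corootReflection, ofMul_mul, ofMul_inv, ofMul_zpow, map_add, map_neg, map_zsmul,
    sub_eq_add_neg]

end Reflections

/-! ### The named fact: coroots and (RD 2) -/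

section Facts

variable {G T : Subgroup (GL n k)}

/-- **The coroots of a connected reductive group** (Springer, *Linear Algebraic Groups*, 7.4.3,
with 7.3.5 (i), 8.1.1 (i), 8.1.4 (i)). Let `G` be connected reductive over an algebraically closed
field, `T` a maximal torus and `R = R(G, T) ⊆ X = X*(T)` the set of roots (`roots G T`; by
8.1.1 (i)–8.1.2 the roots defined through root homomorphisms are the roots of 7.4.3). *There is a
map `α ↦ α^∨` of `R` into `X^∨ = X_*(T)` (7.3.5 (i): `α^∨ ∈ X^∨`; 7.4.3) such that:*

* *(realisation; 8.1.1 (i), 8.1.4 (i) and its proof, formula (22)) for every `α ∈ R` the triple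
  `(u_α, u_{-α}, α^∨)` is realised by an algebraic homomorphism `SL₂ → G` (`IsSL2Realization`:
  its restrictions to the unipotent subgroups of `SL₂` are root homomorphisms for `±α` and
  `diag(t, t⁻¹) ↦ α^∨(t)`);*
* *(axiom (RD 2) of 7.4.1; 7.4.3: "the axioms (RD 1) and (RD 2) hold (see 7.1.8 (i) and 7.1.4)")
  for `α, β ∈ R`: `s_α(β) = β - ⟨β, α^∨⟩ α ∈ R` and `s_α^∨(β^∨) = β^∨ - ⟨α, β^∨⟩ α^∨ ∈ R^∨`,
  where `R^∨` is the image of `R`.*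

(RD 1), `⟨α, α^∨⟩ = 2`, follows from the realisation (`IsSL2Realization.charPairingInt_eq_two`);
injectivity of `α ↦ α^∨` (7.4.3) is `injective_of_mapsTo_preReflection`. The map is stated as a
function on all of `X*(T)`; only its values on `R` matter.
[cite: SpringerLAG1998, 7.4.3 with 7.3.5 (i), 8.1.1 (i), 8.1.4 (i)] -/
def exists_corootMap : Prop :=
  ∀ [IsAlgClosed k] (_hG : IsConnectedReductive G) (hT : IsMaximalTorusIn T G)
    [IsMulCommutative ↥T],
    ∃ cr : ↥(characterLattice T) → ↥(cocharacterLattice T),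
      (∀ α ∈ roots G T, ∃ φ : SL(2, k) →* ↥G,
        IsSL2Realization G T hT.1 (α : ↥T →* kˣ) (cr α : kˣ →* ↥T) φ) ∧
      (∀ α ∈ roots G T, ∀ β ∈ roots G T,
        rootReflection α (cr α) β ∈ roots G T ∧
          corootReflection α (cr α) (cr β) ∈ cr '' roots G T)

end Facts

/-! ### Combinatorial lemmas for the assembly -/

section Combinatorics

/-- **Injectivity of `α ↦ α^∨`** (Springer 7.4.3), abstractly: let `p : L × M → ℤ` be bilinear
with `L` torsion-free, `rt : ι → L` injective with finite image ("roots") and `ct : ι → M`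
("coroots") with `p (rt i) (ct i) = 2` and each reflection `x ↦ x - p x (ct i) • rt i` preserving
the image of `rt`. Then `ct` is injective. This is Mathlib's
`Module.eq_of_mapsTo_reflection_of_mem` (the orbit argument of Springer 7.4.3 / [SGA 3, XXI,
1.1.4]: if `ct i = ct j` then the `(s_i s_j)^t (rt j) = rt j + 2t (rt i - rt j)` are infinitely
many roots unless `rt i = rt j`; the finiteness of the set of roots replaces Springer's
finiteness of the Weyl group), repackaged for indexed families. [cite: SpringerLAG1998, 7.4.3] -/
theorem injective_of_mapsTo_preReflection {ι L M : Type*} [AddCommGroup L] [IsAddTorsionFree L]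
    [AddCommGroup M] (p : L →ₗ[ℤ] M →ₗ[ℤ] ℤ) {rt : ι → L} {ct : ι → M}
    (hfin : (Set.range rt).Finite) (hrt : Function.Injective rt) (hp2 : ∀ i, p (rt i) (ct i) = 2)
    (hr : ∀ i, Set.MapsTo (Module.preReflection (rt i) (p.flip (ct i)))
      (Set.range rt) (Set.range rt)) :
    Function.Injective ct := fun i j hij =>
  hrt (Module.eq_of_mapsTo_reflection_of_mem (f := p.flip (ct i)) (g := p.flip (ct j)) hfin
    (by simpa using hp2 i) (by simpa using hp2 j) (by simpa [← hij] using hp2 i)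
    (by simpa [hij] using hp2 j) (hr i) (hr j) (Set.mem_range_self j))

end Combinatorics

/-! ### The Weyl element of `SL₂` and Springer's formula (22) -/

section SL2

variable {R : Type*} [CommRing R]

/-- The Weyl element `w = (0 1; -1 0) = u⁺(1) u⁻(-1) u⁺(1)` of `SL₂` (Springer 7.2.2 (19):
`n₁`; 8.1.4 (i): `n_α = u_α(1) u_{-α}(-1) u_α(1)`). [cite: SpringerLAG1998, 8.1.4 (i)] -/
def weylSL2 : SL(2, R) :=
  ⟨!![0, 1; -1, 0], by simp [Matrix.det_fin_two_of]⟩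

/-- The matrix of `weylSL2`. [folklore] -/
@[simp] lemma coe_weylSL2 : ((weylSL2 : SL(2, R)) : Matrix (Fin 2) (Fin 2) R) = !![0, 1; -1, 0] :=
  rfl

/-- `u⁺(1) u⁻(-1) u⁺(1) = w` in `SL₂` (Springer 8.1.4 (i), the definition of `n_α`, checked in
`SL₂`). [cite: SpringerLAG1998, 8.1.4 (i)] -/
theorem unipotentUpperSL2_mul_unipotentLowerSL2_mul_unipotentUpperSL2_one :
    unipotentUpperSL2 (Multiplicative.ofAdd (1 : R)) *
        unipotentLowerSL2 (Multiplicative.ofAdd (-1 : R)) *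
      unipotentUpperSL2 (Multiplicative.ofAdd (1 : R)) = weylSL2 := by
  refine Subtype.ext ?_
  simp

/-- **Springer's formula (22) in `SL₂`**: `u⁺(x) u⁻(-x⁻¹) u⁺(x) = diag(x, x⁻¹) · w` for a unit
`x` (8.1.4 (22): `u_α(x) u_{-α}(-x⁻¹) u_α(x) = α^∨(x) n_α`, checked in `SL₂`).
[cite: SpringerLAG1998, 8.1.4 (22)] -/
theorem unipotentUpperSL2_mul_unipotentLowerSL2_mul_unipotentUpperSL2 (x : Rˣ) :
    unipotentUpperSL2 (Multiplicative.ofAdd (x : R)) *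
        unipotentLowerSL2 (Multiplicative.ofAdd (-((x⁻¹ : Rˣ) : R))) *
      unipotentUpperSL2 (Multiplicative.ofAdd (x : R)) = diagSL2 x * weylSL2 := by
  refine Subtype.ext ?_
  simp [mul_neg, Units.mul_inv]

/-- `w² = diag(-1, -1) = α^∨(-1)` in `SL₂` (Springer 7.2.2 (19), 7.3.5 (ii), 8.1.4 (ii):
`n_α² = α^∨(-1)`). [cite: SpringerLAG1998, 8.1.4 (ii)] -/
theorem weylSL2_mul_weylSL2 : (weylSL2 : SL(2, R)) * weylSL2 = diagSL2 (-1) := by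
  refine Subtype.ext ?_
  simp [inv_neg]

end SL2

/-! ### Bilinearity of the pairing `⟨χ, λ⟩` -/

section PairingBilinear

variable {T : Subgroup (GL n k)}

/-- `⟨χ ψ, λ⟩ = ⟨χ, λ⟩ + ⟨ψ, λ⟩` for algebraic `χ, ψ, λ` over an infinite field (the pairing of
Springer 3.2.11 (i) is additive in the character). [cite: SpringerLAG1998, 3.2.11 (i)] -/
theorem charPairingInt_mul_left [Infinite k] {χ ψ : ↥T →* kˣ} {γ : kˣ →* ↥T}
    (hχ : IsAlgebraicChar χ) (hψ : IsAlgebraicChar ψ) (hγ : IsAlgebraicCochar γ) :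
    charPairingInt (χ * ψ) γ = charPairingInt χ γ + charPairingInt ψ γ := by
  apply charPairingInt_eq_of_comp_eq
  ext x : 1
  rw [MonoidHom.comp_apply, MonoidHom.mul_apply, charPairingInt_spec_holds hχ hγ x,
    charPairingInt_spec_holds hψ hγ x, zpowGroupHom_apply, zpow_add]

/-- `⟨χ⁻¹, λ⟩ = -⟨χ, λ⟩`. [cite: SpringerLAG1998, 3.2.11 (i)] -/
theorem charPairingInt_inv_left [Infinite k] {χ : ↥T →* kˣ} {γ : kˣ →* ↥T}
    (hχ : IsAlgebraicChar χ) (hγ : IsAlgebraicCochar γ) :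
    charPairingInt χ⁻¹ γ = -charPairingInt χ γ := by
  apply charPairingInt_eq_of_comp_eq
  ext x : 1
  rw [MonoidHom.comp_apply, MonoidHom.inv_apply, charPairingInt_spec_holds hχ hγ x,
    zpowGroupHom_apply, zpow_neg]

/-- `⟨χ ^ m, λ⟩ = m ⟨χ, λ⟩`. [cite: SpringerLAG1998, 3.2.11 (i)] -/
theorem charPairingInt_zpow_left [Infinite k] {χ : ↥T →* kˣ} {γ : kˣ →* ↥T}
    (hχ : IsAlgebraicChar χ) (hγ : IsAlgebraicCochar γ) (m : ℤ) :
    charPairingInt (χ ^ m) γ = m * charPairingInt χ γ := by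
  apply charPairingInt_eq_of_comp_eq
  ext x : 1
  rw [MonoidHom.comp_apply, MonoidHom.zpow_apply, charPairingInt_spec_holds hχ hγ x,
    zpowGroupHom_apply, mul_comm, zpow_mul]

variable [IsMulCommutative ↥T]

/-- `⟨χ, λ μ⟩ = ⟨χ, λ⟩ + ⟨χ, μ⟩` for algebraic `χ, λ, μ` (`T` commutative; the pairing is additive
in the cocharacter). [cite: SpringerLAG1998, 3.2.11 (i)] -/
theorem charPairingInt_mul_right [Infinite k] {χ : ↥T →* kˣ} {γ μ : kˣ →* ↥T}
    (hχ : IsAlgebraicChar χ) (hγ : IsAlgebraicCochar γ) (hμ : IsAlgebraicCochar μ) :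
    charPairingInt χ (γ * μ) = charPairingInt χ γ + charPairingInt χ μ := by
  apply charPairingInt_eq_of_comp_eq
  ext x : 1
  rw [MonoidHom.comp_apply, MonoidHom.mul_apply, map_mul, charPairingInt_spec_holds hχ hγ x,
    charPairingInt_spec_holds hχ hμ x, zpowGroupHom_apply, zpow_add]

/-- `⟨χ, λ⁻¹⟩ = -⟨χ, λ⟩`. [cite: SpringerLAG1998, 3.2.11 (i)] -/
theorem charPairingInt_inv_right [Infinite k] {χ : ↥T →* kˣ} {γ : kˣ →* ↥T}
    (hχ : IsAlgebraicChar χ) (hγ : IsAlgebraicCochar γ) :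
    charPairingInt χ γ⁻¹ = -charPairingInt χ γ := by
  apply charPairingInt_eq_of_comp_eq
  ext x : 1
  rw [MonoidHom.comp_apply, MonoidHom.inv_apply, map_inv, charPairingInt_spec_holds hχ hγ x,
    zpowGroupHom_apply, zpow_neg]

/-- `⟨χ, λ ^ m⟩ = m ⟨χ, λ⟩`. [cite: SpringerLAG1998, 3.2.11 (i)] -/
theorem charPairingInt_zpow_right [Infinite k] {χ : ↥T →* kˣ} {γ : kˣ →* ↥T}
    (hχ : IsAlgebraicChar χ) (hγ : IsAlgebraicCochar γ) (m : ℤ) :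
    charPairingInt χ (γ ^ m) = m * charPairingInt χ γ := by
  apply charPairingInt_eq_of_comp_eq
  ext x : 1
  rw [MonoidHom.comp_apply, MonoidHom.zpow_apply, map_zpow, charPairingInt_spec_holds hχ hγ x,
    zpowGroupHom_apply, mul_comm, zpow_mul]

end PairingBilinear

/-! ### The reflection `t ↦ t · α^∨(α(t))⁻¹` of `T` -/

section ReflConj

variable {T : Subgroup (GL n k)} [IsMulCommutative ↥T]

/-- The endomorphism `t ↦ t · α^∨(α(t))⁻¹` of a commutative `T`, attached to a character `α` and
a cocharacter `α^∨`: this is how the Weyl element `n_α` acts on `T` by conjugation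
(`IsSL2Realization.weyl_mul_inclusion_mul_weyl_inv`; Springer 7.1.8, 7.3.5: `s_α(t) = t⁻¹` on
`T₁ = Im α^∨`, identity on `(Ker α)°`). [cite: SpringerLAG1998, 7.1.8 and 7.3.4–7.3.5] -/
def reflConj (α : ↥T →* kˣ) (αv : kˣ →* ↥T) : ↥T →* ↥T :=
  MonoidHom.id ↥T * (αv.comp α)⁻¹

/-- `reflConj α α^∨ t = t · α^∨(α(t))⁻¹`. [folklore] -/
@[simp] lemma reflConj_apply (α : ↥T →* kˣ) (αv : kˣ →* ↥T) (t : ↥T) :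
    reflConj α αv t = t * (αv (α t))⁻¹ := rfl

/-- If `α ∘ α^∨ = (x ↦ x²)` ((RD 1)), then `t ↦ t · α^∨(α(t))⁻¹` is an involution (`s_α² = 1`).
[cite: SpringerLAG1998, 7.1.8] -/
theorem reflConj_reflConj {α : ↥T →* kˣ} {αv : kˣ →* ↥T} (h2 : α.comp αv = zpowGroupHom 2)
    (t : ↥T) : reflConj α αv (reflConj α αv t) = t := by
  have h : ∀ y : kˣ, α (αv y) = y ^ (2 : ℤ) := fun y => by
    rw [← MonoidHom.comp_apply, h2, zpowGroupHom_apply]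
  rw [reflConj_apply, reflConj_apply, map_mul, map_inv, h, map_mul, map_inv, map_zpow, mul_inv,
    inv_inv, zpow_two]
  group

/-- The involution `t ↦ t · α^∨(α(t))⁻¹` of `T` as a group automorphism, given (RD 1).
[cite: SpringerLAG1998, 7.1.8] -/
def reflConjEquiv {α : ↥T →* kˣ} {αv : kˣ →* ↥T} (h2 : α.comp αv = zpowGroupHom 2) :
    ↥T ≃* ↥T :=
  { reflConj α αv with
    invFun := reflConj α αv
    left_inv := reflConj_reflConj h2
    right_inv := reflConj_reflConj h2 }

/-- `reflConjEquiv` is `reflConj` as a function. [folklore] -/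
@[simp] lemma coe_reflConjEquiv {α : ↥T →* kˣ} {αv : kˣ →* ↥T}
    (h2 : α.comp αv = zpowGroupHom 2) : ⇑(reflConjEquiv h2) = reflConj α αv := rfl

/-- `reflConjEquiv` as a monoid homomorphism is `reflConj`. [folklore] -/
@[simp] lemma reflConjEquiv_toMonoidHom {α : ↥T →* kˣ} {αv : kˣ →* ↥T}
    (h2 : α.comp αv = zpowGroupHom 2) : (reflConjEquiv h2).toMonoidHom = reflConj α αv := rfl

/-- **`n_α` acts on characters by `s_α`**: `χ ∘ (t ↦ t · α^∨(α t)⁻¹) = χ - ⟨χ, α^∨⟩ α`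
(`rootReflection`; Springer 7.1.8: `s_α(x) = x - ⟨x, α^∨⟩ α`).
[cite: SpringerLAG1998, 7.1.8 and 7.3.4] -/
theorem coe_rootReflection_eq_comp_reflConj [Infinite k] (α : ↥(characterLattice T))
    (αv : ↥(cocharacterLattice T)) (χ : ↥(characterLattice T)) :
    ((rootReflection α αv χ : ↥(characterLattice T)) : ↥T →* kˣ) =
      (χ : ↥T →* kˣ).comp (reflConj (α : ↥T →* kˣ) (αv : kˣ →* ↥T)) := by
  ext t : 1
  rw [rootReflection, Subgroup.coe_mul, Subgroup.coe_inv, SubgroupClass.coe_zpow,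
    MonoidHom.mul_apply, MonoidHom.inv_apply, MonoidHom.zpow_apply, MonoidHom.comp_apply,
    reflConj_apply, map_mul, map_inv, charPairingInt_spec_holds χ.2 αv.2]

/-- **`n_α` acts on cocharacters by `s_α^∨`**: `(t ↦ t · α^∨(α t)⁻¹) ∘ λ = λ - ⟨α, λ⟩ α^∨`
(`corootReflection`; Springer 7.3.5: `s_α^∨(y) = y - ⟨α, y⟩ α^∨`). [cite: SpringerLAG1998, 7.3.5] -/
theorem coe_corootReflection_eq_reflConj_comp [Infinite k] (α : ↥(characterLattice T))
    (αv : ↥(cocharacterLattice T)) (γ : ↥(cocharacterLattice T)) :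
    ((corootReflection α αv γ : ↥(cocharacterLattice T)) : kˣ →* ↥T) =
      (reflConj (α : ↥T →* kˣ) (αv : kˣ →* ↥T)).comp (γ : kˣ →* ↥T) := by
  ext x : 1
  rw [corootReflection, Subgroup.coe_mul, Subgroup.coe_inv, SubgroupClass.coe_zpow,
    MonoidHom.mul_apply, MonoidHom.inv_apply, MonoidHom.zpow_apply, MonoidHom.comp_apply,
    reflConj_apply, charPairingInt_spec_holds α.2 γ.2, map_zpow]

end ReflConj

/-! ### The Weyl element `n_α = φ(w)` of an `SL₂`-realisation -/

section WeylElement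

variable {G T : Subgroup (GL n k)}
variable {hTG : T ≤ G} {α : ↥T →* kˣ} {αv : kˣ →* ↥T} {φ : SL(2, k) →* ↥G}

/-- **Springer 8.1.4 (22) in `G`**: if `φ : SL₂ → G` realises `(α, α^∨)` and `n = φ(w)`, then
`t n t⁻¹ = α^∨(α(t)) n` for `t ∈ T` (conjugate `n = u_α(1) u_{-α}(-1) u_α(1)` by `t` and use
`u_α(a) u_{-α}(-a⁻¹) u_α(a) = α^∨(a) n_α` with `a = α(t)`).
[cite: SpringerLAG1998, 8.1.4 (i), (22)] -/
theorem IsSL2Realization.inclusion_mul_weyl_mul_inv (h : IsSL2Realization G T hTG α αv φ)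
    (t : ↥T) :
    Subgroup.inclusion hTG t * φ weylSL2 * (Subgroup.inclusion hTG t)⁻¹ =
      Subgroup.inclusion hTG (αv (α t)) * φ weylSL2 := by
  obtain ⟨-, hu, hl, hdiag⟩ := h
  have hup := hu.2.2 t 1
  have hlo := hl.2.2 t (-1)
  simp only [MonoidHom.comp_apply, mul_one, MonoidHom.inv_apply, mul_neg_one] at hup hlo
  set c := Subgroup.inclusion hTG t
  rw [← unipotentUpperSL2_mul_unipotentLowerSL2_mul_unipotentUpperSL2_one, map_mul, map_mul,
    show c * (φ (unipotentUpperSL2 (Multiplicative.ofAdd 1)) *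
        φ (unipotentLowerSL2 (Multiplicative.ofAdd (-1))) *
        φ (unipotentUpperSL2 (Multiplicative.ofAdd 1))) * c⁻¹ =
      (c * φ (unipotentUpperSL2 (Multiplicative.ofAdd 1)) * c⁻¹) *
        (c * φ (unipotentLowerSL2 (Multiplicative.ofAdd (-1))) * c⁻¹) *
        (c * φ (unipotentUpperSL2 (Multiplicative.ofAdd 1)) * c⁻¹) by group,
    hup, hlo, ← map_mul, ← map_mul, unipotentUpperSL2_mul_unipotentLowerSL2_mul_unipotentUpperSL2,
    map_mul, hdiag, ← map_mul φ, ← map_mul φ,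
    unipotentUpperSL2_mul_unipotentLowerSL2_mul_unipotentUpperSL2_one]

/-- `n² = α^∨(-1)` for `n = φ(w)` (Springer 7.3.5 (ii), 8.1.4 (ii)).
[cite: SpringerLAG1998, 8.1.4 (ii)] -/
theorem IsSL2Realization.weyl_mul_weyl (h : IsSL2Realization G T hTG α αv φ) :
    φ weylSL2 * φ weylSL2 = Subgroup.inclusion hTG (αv (-1)) := by
  rw [← map_mul, weylSL2_mul_weylSL2, h.2.2.2]

variable [IsMulCommutative ↥T]

/-- **`n_α` normalises `T` and acts on it by `t ↦ t · α^∨(α(t))⁻¹`** (Springer 8.1.4 (i):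
`n_α ∈ N_G(T)` with image `s_α` in `W`): `n t n⁻¹ = t · α^∨(α(t))⁻¹` for `n = φ(w)`.
[cite: SpringerLAG1998, 8.1.4 (i)] -/
theorem IsSL2Realization.weyl_mul_inclusion_mul_weyl_inv (h : IsSL2Realization G T hTG α αv φ)
    (t : ↥T) :
    φ weylSL2 * Subgroup.inclusion hTG t * (φ weylSL2)⁻¹ =
      Subgroup.inclusion hTG (reflConj α αv t) := by
  have h1 := h.inclusion_mul_weyl_mul_inv t⁻¹
  rw [map_inv, inv_inv] at h1
  calc φ weylSL2 * Subgroup.inclusion hTG t * (φ weylSL2)⁻¹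
      = Subgroup.inclusion hTG t * ((Subgroup.inclusion hTG t)⁻¹ * φ weylSL2 *
          Subgroup.inclusion hTG t) * (φ weylSL2)⁻¹ := by group
    _ = Subgroup.inclusion hTG t * (Subgroup.inclusion hTG (αv (α t⁻¹)) * φ weylSL2) *
          (φ weylSL2)⁻¹ := by rw [h1]
    _ = Subgroup.inclusion hTG (reflConj α αv t) := by
      rw [reflConj_apply, map_mul (Subgroup.inclusion hTG), map_inv α, map_inv αv,
        map_inv (Subgroup.inclusion hTG)]
      group

/-- The same for `n⁻¹`: `n⁻¹ t n = t · α^∨(α(t))⁻¹` (as `n² = α^∨(-1) ∈ T` is central in `T`).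
[cite: SpringerLAG1998, 8.1.4 (i)–(ii)] -/
theorem IsSL2Realization.weyl_inv_mul_inclusion_mul_weyl (h : IsSL2Realization G T hTG α αv φ)
    (t : ↥T) :
    (φ weylSL2)⁻¹ * Subgroup.inclusion hTG t * φ weylSL2 =
      Subgroup.inclusion hTG (reflConj α αv t) := by
  have hsq := h.weyl_mul_weyl
  have h1 := h.weyl_mul_inclusion_mul_weyl_inv t
  have hcomm : Subgroup.inclusion hTG (αv (-1)) * Subgroup.inclusion hTG (reflConj α αv t) =
      Subgroup.inclusion hTG (reflConj α αv t) * Subgroup.inclusion hTG (αv (-1)) := by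
    rw [← map_mul, ← map_mul, mul_comm]
  calc (φ weylSL2)⁻¹ * Subgroup.inclusion hTG t * φ weylSL2
      = (φ weylSL2 * φ weylSL2)⁻¹ * (φ weylSL2 * Subgroup.inclusion hTG t * (φ weylSL2)⁻¹) *
          (φ weylSL2 * φ weylSL2) := by group
    _ = Subgroup.inclusion hTG (reflConj α αv t) := by
      rw [h1, hsq, mul_assoc, inv_mul_eq_iff_eq_mul, hcomm]

end WeylElement

/-! ### Conjugating root homomorphisms and `SL₂`-realisations by the Weyl element -/

section Conjugation

variable {G T : Subgroup (GL n k)}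

open Polynomial in
/-- **Conjugates of root homomorphisms**: if `u` is a root homomorphism for `β` and `m ∈ G`
normalises `T`, acting on it through the automorphism `σ` (`m⁻¹ t m = σ(t)`), then
`x ↦ m u(x) m⁻¹` is a root homomorphism for `β ∘ σ` (Springer 8.1.1 with 7.1.4: `N_G(T)` permutes
the root subgroups, `n U_β n⁻¹ = U_{w.β}`). [cite: SpringerLAG1998, 8.1.1 (i) with 7.1.4] -/
theorem IsRootHom.conj {hTG : T ≤ G} {β : ↥T →* kˣ} {u : Multiplicative k →* ↥G}
    (hu : IsRootHom G T hTG β u) {m : ↥G} {σ : ↥T ≃* ↥T}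
    (hm : ∀ t : ↥T, m⁻¹ * Subgroup.inclusion hTG t * m = Subgroup.inclusion hTG (σ t)) :
    IsRootHom G T hTG (β.comp σ.toMonoidHom) ((MulAut.conj m).toMonoidHom.comp u) := by
  obtain ⟨⟨P, hP⟩, ⟨q, hq⟩, hequiv⟩ := hu
  refine ⟨⟨fun c => MvPolynomial.eval₂ Polynomial.C P
      (conjPolyGL ((m : ↥G) : GL n k) (((m : ↥G) : GL n k)⁻¹) c), fun x c => ?_⟩,
    ⟨MvPolynomial.bind₁ (conjPolyGL (((m : ↥G) : GL n k)⁻¹) ((m : ↥G) : GL n k)) q, fun x => ?_⟩,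
    fun t x => ?_⟩
  · have hx : (fun d => (P d).eval x) =
        glCoordFun ((u (Multiplicative.ofAdd x) : ↥G) : GL n k) :=
      funext fun d => (hP x d).symm
    rw [eval_mvPolynomialEval₂_C, hx, eval_conjPolyGL]
    simp
  · rw [eval_bind₁]
    simp only [eval_conjPolyGL, MonoidHom.coe_comp, Function.comp_apply, MulEquiv.coe_toMonoidHom,
      MulAut.conj_apply, Subgroup.coe_mul, InvMemClass.coe_inv]
    rw [show (((m : ↥G) : GL n k))⁻¹ * ((m : ↥G) * ((u (Multiplicative.ofAdd x) : ↥G) : GL n k) *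
        ((m : ↥G) : GL n k)⁻¹) * (m : ↥G) = ((u (Multiplicative.ofAdd x) : ↥G) : GL n k) by group]
    exact hq x
  · have h1 := hequiv (σ t) x
    rw [← hm] at h1
    simp only [MonoidHom.coe_comp, Function.comp_apply, MulEquiv.coe_toMonoidHom, MulAut.conj_apply]
    rw [← h1]
    group

/-- **Conjugates of algebraic homomorphisms `SL₂ → G`** by elements of `G` are algebraic (inner
automorphisms are morphisms, Springer 2.1.2). [cite: SpringerLAG1998, 2.1.2] -/
theorem IsAlgebraicSL2Hom.conj {φ : SL(2, k) →* ↥G} (hφ : IsAlgebraicSL2Hom φ) (m : ↥G) :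
    IsAlgebraicSL2Hom ((MulAut.conj m).toMonoidHom.comp φ) := by
  obtain ⟨P, hP⟩ := hφ
  refine ⟨fun c => MvPolynomial.bind₁ P
    (conjPolyGL ((m : ↥G) : GL n k) (((m : ↥G) : GL n k)⁻¹) c), fun g c => ?_⟩
  have hg : (fun d => MvPolynomial.eval (fun ij : Fin 2 × Fin 2 => (g : Matrix (Fin 2) (Fin 2) k)
      ij.1 ij.2) (P d)) = glCoordFun ((φ g : ↥G) : GL n k) := funext fun d => (hP g d).symm
  rw [eval_bind₁, hg, eval_conjPolyGL]
  simp

variable [IsMulCommutative ↥T]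

/-- **Reflecting an `SL₂`-realisation by `n_α`**: if `φ` realises `(α, α^∨)` and `ψ` realises
`(β, β^∨)`, then `Int(n_α) ∘ ψ` (`n_α = φ(w)`) realises `(s_α(β), s_α^∨(β^∨))` — the root
homomorphisms `n_α u_{±β} n_α⁻¹` belong to `±s_α(β)` and `n_α β^∨ n_α⁻¹ = s_α^∨(β^∨)`
(Springer 8.1.4 (i): `n_α ∈ N_G(T)` represents `s_α`; 7.1.8, 7.3.5, 7.4.3: `s_α(R) = R`,
`s_α^∨(R^∨) = R^∨`). [cite: SpringerLAG1998, 8.1.4 (i) with 7.1.8, 7.3.5, 7.4.3] -/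
theorem IsSL2Realization.reflect [Infinite k] {hTG : T ≤ G} {α β : ↥(characterLattice T)}
    {αv βv : ↥(cocharacterLattice T)} {φ ψ : SL(2, k) →* ↥G}
    (hα : IsSL2Realization G T hTG (α : ↥T →* kˣ) (αv : kˣ →* ↥T) φ)
    (hβ : IsSL2Realization G T hTG (β : ↥T →* kˣ) (βv : kˣ →* ↥T) ψ) :
    IsSL2Realization G T hTG ((rootReflection α αv β : ↥(characterLattice T)) : ↥T →* kˣ)
      ((corootReflection α αv βv : ↥(cocharacterLattice T)) : kˣ →* ↥T)
      ((MulAut.conj (φ weylSL2)).toMonoidHom.comp ψ) := by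
  have h2 : (α : ↥T →* kˣ).comp (αv : kˣ →* ↥T) = zpowGroupHom 2 := hα.comp_eq_zpowGroupHom_two
  have hm : ∀ t : ↥T, (φ weylSL2)⁻¹ * Subgroup.inclusion hTG t * φ weylSL2 =
      Subgroup.inclusion hTG (reflConjEquiv h2 t) := fun t => by
    rw [coe_reflConjEquiv]
    exact hα.weyl_inv_mul_inclusion_mul_weyl t
  have hroot : ((rootReflection α αv β : ↥(characterLattice T)) : ↥T →* kˣ) =
      (β : ↥T →* kˣ).comp (reflConjEquiv h2).toMonoidHom := by
    rw [reflConjEquiv_toMonoidHom]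
    exact coe_rootReflection_eq_comp_reflConj α αv β
  obtain ⟨halg, hu, hl, hdiag⟩ := hβ
  refine ⟨halg.conj _, ?_, ?_, fun t => ?_⟩
  · rw [hroot, MonoidHom.comp_assoc]
    exact hu.conj hm
  · rw [hroot, ← MonoidHom.inv_comp, MonoidHom.comp_assoc]
    exact hl.conj hm
  · rw [MonoidHom.comp_apply, hdiag, MulEquiv.coe_toMonoidHom, MulAut.conj_apply,
      hα.weyl_mul_inclusion_mul_weyl_inv, coe_corootReflection_eq_reflConj_comp,
      MonoidHom.comp_apply]

/-- A reflected root is non-trivial: if `β ≠ 1` is algebraic then `s_α(β) ≠ 1`, granted (RD 1)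
`⟨α, α^∨⟩ = 2` (if `β = ⟨β, α^∨⟩ • α` then pairing with `α^∨` gives `⟨β, α^∨⟩ = 0`, so `β = 0`).
[cite: SpringerLAG1998, 7.4.3] -/
theorem rootReflection_ne_one [Infinite k] {α β : ↥(characterLattice T)}
    {αv : ↥(cocharacterLattice T)}
    (h2 : charPairingInt (α : ↥T →* kˣ) (αv : kˣ →* ↥T) = 2) (hβ : (β : ↥T →* kˣ) ≠ 1) :
    ((rootReflection α αv β : ↥(characterLattice T)) : ↥T →* kˣ) ≠ 1 := by
  intro h
  set m := charPairingInt (β : ↥T →* kˣ) (αv : kˣ →* ↥T) with hm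
  have hβα : β = α ^ m := by
    have h' : rootReflection α αv β = 1 := Subtype.ext h
    rw [rootReflection] at h'
    exact mul_inv_eq_one.mp h'
  have hm0 : m = 0 := by
    have := hm
    rw [hβα, SubgroupClass.coe_zpow, charPairingInt_zpow_left α.2 αv.2, h2] at this
    omega
  apply hβ
  rw [hβα, hm0, zpow_zero, Subgroup.coe_one]

end Conjugation

/-! ### Rigidity: an algebraic character has finitely many conjugates (Springer 3.2.8–3.2.9) -/

section FiniteConjugates

variable {T : Subgroup (GL n k)}

/-- The space of polynomial functions on `T` that are `k`-linear combinations of products of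
exactly `e` coordinate functions `t ↦ t_{ij}`, `t ↦ det(t)⁻¹`. [folklore] -/
def coordMonomialSpan (T : Subgroup (GL n k)) (e : ℕ) : Submodule k (↥T → k) :=
  Submodule.span k (Set.range fun c : Fin e → GLCoord n => fun t : ↥T =>
    ∏ l, glCoordFun (t : GL n k) (c l))

/-- Products: `W_a · W_b ⊆ W_{a+b}`. [folklore] -/
theorem mul_mem_coordMonomialSpan {a b : ℕ} {f g : ↥T → k} (hf : f ∈ coordMonomialSpan T a)
    (hg : g ∈ coordMonomialSpan T b) : f * g ∈ coordMonomialSpan T (a + b) := by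
  have h := Submodule.mul_mem_mul hf hg
  rw [coordMonomialSpan, coordMonomialSpan, Submodule.span_mul_span] at h
  refine Submodule.span_mono ?_ h
  rintro _ ⟨_, ⟨c₁, rfl⟩, _, ⟨c₂, rfl⟩, rfl⟩
  refine ⟨Fin.append c₁ c₂, funext fun t => ?_⟩
  simp only [Pi.mul_apply, Fin.prod_univ_add, Fin.append_left, Fin.append_right]

/-- Constants lie in `W_0`. [folklore] -/
theorem const_mem_coordMonomialSpan (a : k) : (fun _ : ↥T => a) ∈ coordMonomialSpan T 0 := by
  have h1 : (fun _ : ↥T => (1 : k)) ∈ coordMonomialSpan T 0 :=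
    Submodule.subset_span ⟨Fin.elim0, funext fun t => by simp⟩
  have : (fun _ : ↥T => a) = a • fun _ : ↥T => (1 : k) := funext fun t => by simp
  rw [this]
  exact Submodule.smul_mem _ a h1

/-- `1 ∈ W_0`. [folklore] -/
theorem one_mem_coordMonomialSpan : (1 : ↥T → k) ∈ coordMonomialSpan T 0 :=
  const_mem_coordMonomialSpan 1

/-- Coordinate functions lie in `W_1`. [folklore] -/
theorem coord_mem_coordMonomialSpan (d : GLCoord n) :
    (fun t : ↥T => glCoordFun (t : GL n k) d) ∈ coordMonomialSpan T 1 :=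
  Submodule.subset_span ⟨fun _ => d, funext fun t => by simp⟩

/-- Powers: `f ∈ W_1 ⇒ f ^ e ∈ W_e`. [folklore] -/
theorem pow_mem_coordMonomialSpan {f : ↥T → k} (hf : f ∈ coordMonomialSpan T 1) (e : ℕ) :
    f ^ e ∈ coordMonomialSpan T e := by
  induction e with
  | zero => simpa using one_mem_coordMonomialSpan (T := T)
  | succ e ih =>
    rw [pow_succ]
    exact mul_mem_coordMonomialSpan ih hf

/-- Finite products: `∏_{c ∈ s} f_c ∈ W_{∑ e_c}` if `f_c ∈ W_{e_c}`. [folklore] -/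
theorem prod_mem_coordMonomialSpan {ι : Type*} (s : Finset ι) {f : ι → ↥T → k} {e : ι → ℕ}
    (hf : ∀ c ∈ s, f c ∈ coordMonomialSpan T (e c)) :
    ∏ c ∈ s, f c ∈ coordMonomialSpan T (∑ c ∈ s, e c) := by
  classical
  induction s using Finset.induction_on with
  | empty => simpa using one_mem_coordMonomialSpan (T := T)
  | insert c s hc ih =>
    rw [Finset.prod_insert hc, Finset.sum_insert hc]
    exact mul_mem_coordMonomialSpan (hf c (Finset.mem_insert_self c s))
      (ih fun c' hc' => hf c' (Finset.mem_insert_of_mem hc'))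

/-- The coordinates of `h t h⁻¹` are linear combinations of the coordinates of `t`
(entries: `(h t h⁻¹)_{ij} = ∑ h_{ia} t_{ab} (h⁻¹)_{bj}`; `det(h t h⁻¹)⁻¹ = det(t)⁻¹`), hence lie in
`W_1`. [folklore] -/
theorem coord_conj_mem_coordMonomialSpan (h : GL n k) (c : GLCoord n) :
    (fun t : ↥T => glCoordFun (h * (t : GL n k) * h⁻¹) c) ∈ coordMonomialSpan T 1 := by
  rcases c with ⟨i, j⟩ | u
  · have hfun : (fun t : ↥T => glCoordFun (h * (t : GL n k) * h⁻¹) (Sum.inl (i, j))) =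
        ∑ b, ∑ a, ((h : Matrix n n k) i a * ((h⁻¹ : GL n k) : Matrix n n k) b j) •
          fun t : ↥T => glCoordFun (t : GL n k) (Sum.inl (a, b)) := by
      funext t
      simp only [glCoordFun_inl, Units.val_mul, Matrix.mul_apply, Finset.sum_apply,
        Pi.smul_apply, smul_eq_mul, Finset.sum_mul]
      refine Finset.sum_congr rfl fun b _ => Finset.sum_congr rfl fun a _ => ?_
      ring
    rw [hfun]
    exact Submodule.sum_mem _ fun b _ => Submodule.sum_mem _ fun a _ =>
      Submodule.smul_mem _ _ (coord_mem_coordMonomialSpan _)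
  · have hfun : (fun t : ↥T => glCoordFun (h * (t : GL n k) * h⁻¹) (Sum.inr u)) =
        fun t : ↥T => glCoordFun (t : GL n k) (Sum.inr u) := by
      funext t
      simp only [glCoordFun_inr, ← Matrix.GeneralLinearGroup.val_det_apply, map_mul, map_inv,
        mul_inv_cancel_comm]
    rw [hfun]
    exact coord_mem_coordMonomialSpan _

/-- A polynomial of total degree `≤ D` in the coordinates of `h t h⁻¹` is, as a function of
`t ∈ T`, in `∑_{e ≤ D} W_e`. [folklore] -/
theorem eval_conj_mem_iSup_coordMonomialSpan (h : GL n k) (p : MvPolynomial (GLCoord n) k) :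
    (fun t : ↥T => MvPolynomial.eval (glCoordFun (h * (t : GL n k) * h⁻¹)) p) ∈
      ⨆ e ∈ Finset.range (p.totalDegree + 1), coordMonomialSpan T e := by
  classical
  have hfun : (fun t : ↥T => MvPolynomial.eval (glCoordFun (h * (t : GL n k) * h⁻¹)) p) =
      ∑ s ∈ p.support, p.coeff s • ∏ c, (fun t : ↥T => glCoordFun (h * (t : GL n k) * h⁻¹) c) ^
        s c := by
    funext t
    rw [MvPolynomial.eval_eq']
    simp only [Finset.sum_apply, Pi.smul_apply, Finset.prod_apply, Pi.pow_apply, smul_eq_mul]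
  rw [hfun]
  refine Submodule.sum_mem _ fun s hs => Submodule.smul_mem _ _ ?_
  have hdeg : ∑ c, s c ≤ p.totalDegree := by
    have := MvPolynomial.le_totalDegree hs
    rwa [Finsupp.sum_fintype _ _ (fun _ => rfl)] at this
  have hmem : ∏ c, (fun t : ↥T => glCoordFun (h * (t : GL n k) * h⁻¹) c) ^ s c ∈
      coordMonomialSpan T (∑ c, s c) :=
    prod_mem_coordMonomialSpan _ fun c _ =>
      pow_mem_coordMonomialSpan (coord_conj_mem_coordMonomialSpan h c) (s c)
  exact Submodule.mem_iSup_of_mem (∑ c, s c)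
    (Submodule.mem_iSup_of_mem (Finset.mem_range.mpr (Nat.lt_succ_of_le hdeg)) hmem)

/-- **An algebraic character has finitely many conjugates** (the mechanism of the rigidity of
diagonalisable groups, Springer 3.2.8–3.2.9, in elementary form): for an algebraic character
`χ` of `T ≤ GL n k`, the characters `t ↦ χ(h t h⁻¹)`, `h ∈ GL n k` normalising `T`, form a
finite set. Indeed they are represented by polynomials of bounded degree, hence lie in a
finite-dimensional space of functions on `T`, and distinct characters are linearly independent
(Dedekind). [cite: SpringerLAG1998, 3.2.8–3.2.9] -/
theorem finite_setOf_isConjugateChar {χ : ↥T →* kˣ} (hχ : IsAlgebraicChar χ) :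
    {ψ : ↥T →* kˣ | ∃ (h : GL n k) (hh : ∀ t : ↥T, h * (t : GL n k) * h⁻¹ ∈ T),
      ∀ t : ↥T, ψ t = χ ⟨h * (t : GL n k) * h⁻¹, hh t⟩}.Finite := by
  classical
  obtain ⟨p, hp⟩ := hχ
  set S := {ψ : ↥T →* kˣ | ∃ (h : GL n k) (hh : ∀ t : ↥T, h * (t : GL n k) * h⁻¹ ∈ T),
      ∀ t : ↥T, ψ t = χ ⟨h * (t : GL n k) * h⁻¹, hh t⟩}
  -- the finite spanning family
  let F : (Σ e : Fin (p.totalDegree + 1), (Fin e → GLCoord n)) → (↥T → k) := fun ec t =>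
    ∏ l, glCoordFun (t : GL n k) (ec.2 l)
  have hW : ∀ e ∈ Finset.range (p.totalDegree + 1),
      coordMonomialSpan T e ≤ Submodule.span k (Set.range F) := by
    intro e he
    refine Submodule.span_le.mpr ?_
    rintro _ ⟨c, rfl⟩
    exact Submodule.subset_span ⟨⟨⟨e, Finset.mem_range.mp he⟩, c⟩, rfl⟩
  have hmem : ∀ ψ ∈ S, (fun t : ↥T => ((ψ t : kˣ) : k)) ∈ Submodule.span k (Set.range F) := by
    rintro ψ ⟨h, hh, hψ⟩
    have hfun : (fun t : ↥T => ((ψ t : kˣ) : k)) =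
        fun t : ↥T => MvPolynomial.eval (glCoordFun (h * (t : GL n k) * h⁻¹)) p := by
      funext t
      rw [hψ t, hp]
    rw [hfun]
    exact (iSup₂_le hW) (eval_conj_mem_iSup_coordMonomialSpan h p)
  have hli : LinearIndependent k fun ψ : ↥S => fun t : ↥T => (((ψ : ↥T →* kˣ) t : kˣ) : k) := by
    let ι : ↥S → (↥T →* k) := fun ψ => (Units.coeHom k).comp (ψ : ↥T →* kˣ)
    have hι : Function.Injective ι := by
      intro ψ ψ' hψ
      apply Subtype.ext
      ext t
      simpa [ι] using DFunLike.congr_fun hψ t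
    exact (linearIndependent_monoidHom (↥T) k).comp ι hι
  have hfin : Finite ↥S :=
    LinearIndependent.finite_of_le_span_finite _ hli (Set.range F) (by
      rintro _ ⟨ψ, rfl⟩
      exact hmem ψ ψ.2)
  exact Set.finite_coe_iff.mp hfin

end FiniteConjugates

/-! ### Uniqueness of the coroot of a root (Springer 7.1.8, 8.1.4) -/

section CorootUnique

variable {G T : Subgroup (GL n k)}

/-- If `m ∈ G` normalises `T`, acting on it by `ρ` (`m t m⁻¹ = ρ(t)`), then `m ^ j` acts by
`ρ ^ j`. [folklore] -/
theorem pow_mul_inclusion_mul_pow_inv {hTG : T ≤ G} {m : ↥G} {ρ : Monoid.End ↥T}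
    (hm : ∀ t : ↥T, m * Subgroup.inclusion hTG t * m⁻¹ = Subgroup.inclusion hTG (ρ t)) (j : ℕ)
    (t : ↥T) :
    m ^ j * Subgroup.inclusion hTG t * (m ^ j)⁻¹ = Subgroup.inclusion hTG ((ρ ^ j) t) := by
  induction j generalizing t with
  | zero => simp
  | succ j ih =>
    rw [pow_succ', pow_succ', Monoid.End.coe_mul, Function.comp_apply, ← hm, ← ih t]
    group

/-- Powers of an algebraic character are algebraic (as bare homomorphisms). [folklore] -/
theorem isAlgebraicChar_coe_zpow (α : ↥(characterLattice T)) (m : ℤ) :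
    IsAlgebraicChar ((α : ↥T →* kˣ) ^ m) :=
  (characterLattice T).zpow_mem α.2 m

variable [IsMulCommutative ↥T]

/-- Two reflections in the same root compose to a transvection: for realisations of `(α, α^∨)`
and `(α, α'^∨)`, `s'_α(s_α(χ)) = χ + (⟨χ, α^∨⟩ - ⟨χ, α'^∨⟩) α` (using (RD 1) for `α'^∨`).
[cite: SpringerLAG1998, 7.1.8] -/
theorem rootReflection_rootReflection_eq [Infinite k] {α χ : ↥(characterLattice T)}
    {αv αv' : ↥(cocharacterLattice T)}
    (h2' : charPairingInt (α : ↥T →* kˣ) (αv' : kˣ →* ↥T) = 2) :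
    rootReflection α αv' (rootReflection α αv χ) =
      χ * α ^ (charPairingInt (χ : ↥T →* kˣ) (αv : kˣ →* ↥T) -
        charPairingInt (χ : ↥T →* kˣ) (αv' : kˣ →* ↥T)) := by
  have hpair : ∀ m : ℤ, charPairingInt ((χ * (α ^ m)⁻¹ : ↥(characterLattice T)) : ↥T →* kˣ)
      (αv' : kˣ →* ↥T) = charPairingInt (χ : ↥T →* kˣ) (αv' : kˣ →* ↥T) - m * 2 := fun m => by
    rw [Subgroup.coe_mul, InvMemClass.coe_inv, SubgroupClass.coe_zpow,
      charPairingInt_mul_left χ.2 (isAlgebraicChar_coe_zpow α m).inv αv'.2,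
      charPairingInt_inv_left (isAlgebraicChar_coe_zpow α m) αv'.2,
      charPairingInt_zpow_left α.2 αv'.2, h2']
    ring
  rw [rootReflection, rootReflection, hpair, mul_assoc, ← zpow_neg, ← zpow_neg, ← zpow_add]
  congr 2
  ring

/-- **The coroot of a root is unique** (Springer 7.1.8 with 7.3.4–7.3.5, 8.1.4: `α^∨` is determined
by `α` through `s_α ∈ W(G, T)`; rigidity of tori, 3.2.9). Elementary form, for any torus `T` in
any `G ≤ GL n` over an algebraically closed field and any non-trivial algebraic `α`: if `φ`, `φ'`
realise `(α, α^∨)` and `(α, α'^∨)` then `α^∨ = α'^∨`. Proof: `g = n_α n'_α ∈ G` normalises `T`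
and acts on `X*(T)` by the transvection `χ ↦ χ + ⟨χ, α^∨ - α'^∨⟩ α`
(`rootReflection_rootReflection_eq`), so the conjugates of `χ` by the powers `g ^ j` are
`χ + j ⟨χ, α^∨ - α'^∨⟩ α`; these are finitely many (`finite_setOf_isConjugateChar`), `X*(T)` is
torsion-free and `α ≠ 0`, whence `⟨χ, α^∨⟩ = ⟨χ, α'^∨⟩` for every `χ ∈ X*(T)`, and characters
separate cocharacters (`exists_dualBases_of_isTorusSubgroup`).
[cite: SpringerLAG1998, 7.1.8 with 7.3.4–7.3.5, 8.1.4, 3.2.9] -/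
theorem IsSL2Realization.coroot_eq [IsAlgClosed k] (hT : IsTorusSubgroup T) {hTG : T ≤ G}
    {α : ↥(characterLattice T)} (hα : (α : ↥T →* kˣ) ≠ 1) {αv αv' : ↥(cocharacterLattice T)}
    {φ φ' : SL(2, k) →* ↥G} (h : IsSL2Realization G T hTG (α : ↥T →* kˣ) (αv : kˣ →* ↥T) φ)
    (h' : IsSL2Realization G T hTG (α : ↥T →* kˣ) (αv' : kˣ →* ↥T) φ') : αv = αv' := by
  classical
  haveI := isMulTorsionFree_characterLattice hT.1
  -- the element `g = n n'` and its action `ρ = σ ∘ σ'` on `T`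
  let ρ : Monoid.End ↥T :=
    (reflConj (α : ↥T →* kˣ) (αv : kˣ →* ↥T)).comp (reflConj (α : ↥T →* kˣ) (αv' : kˣ →* ↥T))
  let g : ↥G := φ weylSL2 * φ' weylSL2
  have hρ : ∀ t : ↥T, g * Subgroup.inclusion hTG t * g⁻¹ = Subgroup.inclusion hTG (ρ t) :=
    fun t => by
    change φ weylSL2 * φ' weylSL2 * Subgroup.inclusion hTG t * (φ weylSL2 * φ' weylSL2)⁻¹ =
      Subgroup.inclusion hTG (reflConj (α : ↥T →* kˣ) (αv : kˣ →* ↥T)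
        (reflConj (α : ↥T →* kˣ) (αv' : kˣ →* ↥T) t))
    rw [← h.weyl_mul_inclusion_mul_weyl_inv, ← h'.weyl_mul_inclusion_mul_weyl_inv]
    group
  -- the pairing difference `c χ = ⟨χ, α^∨⟩ - ⟨χ, α'^∨⟩` and the action on characters
  let c : ↥(characterLattice T) → ℤ := fun χ =>
    charPairingInt (χ : ↥T →* kˣ) (αv : kˣ →* ↥T) - charPairingInt (χ : ↥T →* kˣ) (αv' : kˣ →* ↥T)
  have h2 := h.charPairingInt_eq_two
  have h2' := h'.charPairingInt_eq_two
  have hc_mul : ∀ (χ : ↥(characterLattice T)) (m : ℤ), c (χ * α ^ m) = c χ := fun χ m => by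
    simp only [c]
    rw [Subgroup.coe_mul, SubgroupClass.coe_zpow,
      charPairingInt_mul_left χ.2 (isAlgebraicChar_coe_zpow α m) αv.2,
      charPairingInt_mul_left χ.2 (isAlgebraicChar_coe_zpow α m) αv'.2,
      charPairingInt_zpow_left α.2 αv.2, charPairingInt_zpow_left α.2 αv'.2, h2, h2']
    ring
  have hstep : ∀ χ : ↥(characterLattice T),
      (χ : ↥T →* kˣ).comp ρ = ((χ * α ^ c χ : ↥(characterLattice T)) : ↥T →* kˣ) := by
    intro χ
    rw [← rootReflection_rootReflection_eq h2', coe_rootReflection_eq_comp_reflConj,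
      coe_rootReflection_eq_comp_reflConj, MonoidHom.comp_assoc]
  have hiter : ∀ (χ : ↥(characterLattice T)) (j : ℕ),
      (χ : ↥T →* kˣ).comp (ρ ^ j) = ((χ * α ^ ((j : ℤ) * c χ) : ↥(characterLattice T)) :
        ↥T →* kˣ) := by
    intro χ j
    induction j with
    | zero =>
      rw [pow_zero]
      change (χ : ↥T →* kˣ).comp (MonoidHom.id ↥T) = _
      rw [MonoidHom.comp_id]
      simp
    | succ j ih =>
      rw [pow_succ, show (ρ ^ j * ρ : Monoid.End ↥T) = (ρ ^ j).comp ρ from rfl,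
        ← MonoidHom.comp_assoc, ih, hstep, hc_mul, mul_assoc, ← zpow_add, Nat.cast_succ, add_mul,
        one_mul]
  -- all these characters are conjugates of `χ`, hence finitely many: so `c χ = 0`
  have hc0 : ∀ χ : ↥(characterLattice T), c χ = 0 := by
    intro χ
    by_contra hne
    have hfin := finite_setOf_isConjugateChar χ.2
    let ψ : ℕ → (↥T →* kˣ) := fun j => ((χ * α ^ ((j : ℤ) * c χ) : ↥(characterLattice T)) :
      ↥T →* kˣ)
    have hψmem : ∀ j, ψ j ∈ {ψ : ↥T →* kˣ | ∃ (h : GL n k)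
        (hh : ∀ t : ↥T, h * (t : GL n k) * h⁻¹ ∈ T),
        ∀ t : ↥T, ψ t = (χ : ↥T →* kˣ) ⟨h * (t : GL n k) * h⁻¹, hh t⟩} := by
      intro j
      have hconj : ∀ t : ↥T, ((g ^ j : ↥G) : GL n k) * (t : GL n k) * ((g ^ j : ↥G) : GL n k)⁻¹ =
          (((ρ ^ j) t : ↥T) : GL n k) := fun t => by
        have := congrArg (fun x : ↥G => (x : GL n k)) (pow_mul_inclusion_mul_pow_inv hρ j t)
        simpa using this
      refine ⟨((g ^ j : ↥G) : GL n k), fun t => by rw [hconj t]; exact SetLike.coe_mem _,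
        fun t => ?_⟩
      have hj := DFunLike.congr_fun (hiter χ j) t
      rw [MonoidHom.comp_apply] at hj
      rw [← hj]
      congr 1
      exact Subtype.ext (hconj t).symm
    have hinj : Function.Injective ψ := by
      intro j j' hjj
      have h1 : (χ * α ^ ((j : ℤ) * c χ) : ↥(characterLattice T)) = χ * α ^ ((j' : ℤ) * c χ) :=
        Subtype.ext hjj
      rw [mul_right_inj] at h1
      have h3 : α ^ ((j : ℤ) * c χ - (j' : ℤ) * c χ) = 1 := by
        rw [zpow_sub, h1, mul_inv_cancel]
      rw [IsMulTorsionFree.zpow_eq_one_iff] at h3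
      rcases h3 with h3 | h3
      · exact absurd (congrArg (fun x : ↥(characterLattice T) => (x : ↥T →* kˣ)) h3) hα
      · have : ((j : ℤ) - j') * c χ = 0 := by rw [← h3]; ring
        rcases mul_eq_zero.mp this with h4 | h4
        · omega
        · exact absurd h4 hne
    exact Set.infinite_range_of_injective hinj (hfin.subset (Set.range_subset_iff.mpr hψmem))
  -- characters separate cocharacters
  obtain ⟨r, bX, bY, hpair⟩ := exists_dualBases_of_isTorusSubgroup hT
  have hY : bY (Additive.ofMul αv) = bY (Additive.ofMul αv') := by
    funext i
    have h1 := hc0 (Additive.toMul (bX.symm (Pi.single i 1)))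
    simp only [c, sub_eq_zero, hpair, ofMul_toMul, AddEquiv.apply_symm_apply] at h1
    simpa [Pi.single_apply] using h1
  exact Additive.ofMul.injective (bY.injective hY)

end CorootUnique

/-! ### The remaining input as a named fact, and the assembly of `exists_corootMap` -/

section Facts

variable {G T : Subgroup (GL n k)}

/-- **Existence of `SL₂`-realisations** (Springer, *Linear Algebraic Groups*, 8.1.4 (i) and its
proof, with 8.1.1 (i), 7.2.4, 7.3.3–7.3.5). Let `G` be connected reductive over an algebraically
closed field and `T` a maximal torus. *For every root `α ∈ R(G, T)` there are a cocharacter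
`α^∨ ∈ X_*(T)` and an algebraic homomorphism `φ : SL₂ → G` whose restrictions to the upper and
lower unipotent subgroups are root homomorphisms for `α` and `-α` and with
`φ(diag(x, x⁻¹)) = α^∨(x)`* (`IsSL2Realization`). In Springer: `U_{±α} ⊂ (G_α, G_α)`, where
`G_α = Z_G((Ker α)°)` is connected reductive of semisimple rank one (7.1.3, 7.6.4 (i)) whose
derived group is isomorphic to `SL₂` or `PSL₂` (7.2.4, 7.3.2), and under `SL₂ → (G_α, G_α)` one
may take `u_{±α}` the images of the unipotent subgroups and `α^∨` the image of the diagonal torus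
(proofs of 7.3.3, 7.3.5 and 8.1.4 (i)). This is the structure-theoretic core of 7.4.3.
[cite: SpringerLAG1998, 8.1.4 (i) with 7.2.4, 7.3.3–7.3.5, 8.1.1 (i)] -/
def exists_sl2Realization : Prop :=
  ∀ [IsAlgClosed k] (_hG : IsConnectedReductive G) (hT : IsMaximalTorusIn T G)
    [IsMulCommutative ↥T],
    ∀ α ∈ roots G T, ∃ (αv : ↥(cocharacterLattice T)) (φ : SL(2, k) →* ↥G),
      IsSL2Realization G T hT.1 (α : ↥T →* kˣ) (αv : kˣ →* ↥T) φ

/-- **Assembly of `exists_corootMap` (Springer 7.4.3, (RD 2)) from `SL₂`-realisations**: granted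
the existence of realisations (`exists_sl2Realization`, 8.1.4 (i)), choose a realisation `φ_α` of
every root; then `α ↦ α^∨` satisfies (RD 2): for roots `α, β`, conjugating `φ_β` by
`n_α = φ_α(w)` realises `(s_α(β), s_α^∨(β^∨))` (`IsSL2Realization.reflect`), so `s_α(β)` is a
root (`rootReflection_ne_one`) and, by the uniqueness of its coroot
(`IsSL2Realization.coroot_eq`, 7.1.8), `s_α^∨(β^∨) = (s_α β)^∨ ∈ R^∨`. This is Springer's
"(RD 2) holds, see 7.1.8 (i) and 7.1.4". [cite: SpringerLAG1998, 7.4.3 with 7.1.8 (i), 8.1.4 (i)] -/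
theorem exists_corootMap_of_sl2Realization (h1 : exists_sl2Realization (G := G) (T := T)) :
    exists_corootMap (G := G) (T := T) := by
  intro _ hG hT _
  classical
  have H := h1 hG hT
  choose! cv φ hφ using H
  refine ⟨cv, fun α hα => ⟨φ α, hφ α hα⟩, fun α hα β hβ => ?_⟩
  have hr := (hφ α hα).reflect (hφ β hβ)
  have hmem : rootReflection α (cv α) β ∈ roots G T :=
    ⟨rootReflection_ne_one (hφ α hα).charPairingInt_eq_two hβ.1, hT.1, _, hr.2.1⟩
  exact ⟨hmem, _, hmem, (hφ _ hmem).coroot_eq hT.2.1 hmem.1 hr⟩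

end Facts

end Literature.NumberTheory.Automorphic

/-! ### Assembly: `exists_isRootDatumOf` from the named facts -/

namespace Literature.NumberTheory.Automorphic


variable {k : Type*} [Field k] {n : Type*} [Fintype n] [DecidableEq n] {G T : Subgroup (GL n k)}

/-- **Assembly of lang.S13 (b)** (Springer 7.4.3 with 8.1.1, 8.1.4): the named facts
`exists_corootMap` (coroots realised by `SL₂`, axiom (RD 2)) and `roots_isReduced` (7.4.4)
imply `exists_isRootDatumOf`: a connected reductive `G` with maximal torus `T` over an
algebraically closed field has a reduced root datum `P : RootPairing ι ℤ X Y` with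
`IsRootDatumOf G T P eX eY`. The other two inputs of the printed proof are theorems of the tree:
Springer 3.2.11 (i) (`X*(T)`, `X_*(T)` free of finite rank in perfect duality:
`exists_dualBases_of_isTorusSubgroup`, `TorusCharacters.lean`) and the finiteness of `R`
(`roots_finite_holds`, `RootDataRootsFiniteProofs.lean`). Proof: transport `R ⊆ X*(T)` and
`R^∨ ⊆ X_*(T)` along the dual bases to `X = Y = ℤʳ` with the standard (perfect) pairing, index
`R` by `Fin m`; (RD 1) holds by `IsSL2Realization.charPairingInt_eq_two`, `α ↦ α^∨` is injective
by `injective_of_mapsTo_preReflection`, and Mathlib's `RootPairing.mk'` produces the root pairing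
from (RD 1), (RD 2) and finiteness; the fields of `IsRootDatumOf` hold by construction and `P` is
reduced by `isReduced_of_isRootDatumOf_of_roots_isReduced`.
[cite: SpringerLAG1998, 7.4.3 with 3.2.11 (i), 7.4.4, 8.1.1 (i), 8.1.4 (i)] -/
theorem exists_isRootDatumOf_of_corootMap (hC : exists_corootMap (G := G) (T := T))
    (hE : roots_isReduced (G := G) (T := T)) : exists_isRootDatumOf (G := G) (T := T) := by
  intro _ hG hT _
  classical
  obtain ⟨r, bX, bY, hpair⟩ := exists_dualBases_of_isTorusSubgroup hT.2.1
  obtain ⟨cr, hsl2, hRD⟩ := hC hG hT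
  have hfin : (roots G T).Finite := roots_finite_holds hG hT
  haveI : Finite ↥(roots G T) := hfin.to_subtype
  obtain ⟨m, ⟨e⟩⟩ := Finite.exists_equiv_fin ↥(roots G T)
  -- the lattices `X = Y = ℤʳ` with the standard perfect pairing
  let L : Type := Fin r → ℤ
  let p : L →ₗ[ℤ] L →ₗ[ℤ] ℤ := ((Pi.basisFun ℤ (Fin r)).toDualEquiv).toLinearMap
  have hp : ∀ (χ : ↥(characterLattice T)) (γ : ↥(cocharacterLattice T)),
      p (bX (Additive.ofMul χ)) (bY (Additive.ofMul γ)) =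
        charPairingInt (χ : ↥T →* kˣ) (γ : kˣ →* ↥T) := fun χ γ => by
    rw [hpair]
    exact basisFun_toDual_apply _ _
  -- roots and coroots in coordinates, indexed by `Fin m`
  let rt : Fin m → L := fun i => bX (Additive.ofMul ((e.symm i : ↥(roots G T)) :
    ↥(characterLattice T)))
  let ct : Fin m → L := fun i => bY (Additive.ofMul (cr (e.symm i : ↥(roots G T))))
  have hrt_inj : Function.Injective rt := fun i j hij =>
    e.symm.injective (Subtype.ext (Additive.ofMul.injective (bX.injective hij)))
  have hrange : Set.range rt = (fun α => bX (Additive.ofMul α)) '' roots G T := by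
    ext x
    constructor
    · rintro ⟨i, rfl⟩
      exact ⟨_, (e.symm i).2, rfl⟩
    · rintro ⟨α, hα, rfl⟩
      exact ⟨e ⟨α, hα⟩, by simp [rt]⟩
  -- (RD 1)
  have hp2 : ∀ i, p (rt i) (ct i) = 2 := fun i => by
    obtain ⟨φ, hφ⟩ := hsl2 _ (e.symm i).2
    rw [hp]
    exact hφ.charPairingInt_eq_two
  -- (RD 2)
  have hr : ∀ i, Set.MapsTo (Module.preReflection (rt i) (p.flip (ct i)))
      (Set.range rt) (Set.range rt) := by
    rintro i _ ⟨j, rfl⟩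
    obtain ⟨hmem, -⟩ := hRD _ (e.symm i).2 _ (e.symm j).2
    refine ⟨e ⟨_, hmem⟩, ?_⟩
    simp only [rt, Equiv.symm_apply_apply]
    rw [Module.preReflection_apply, LinearMap.flip_apply, hp, map_rootReflection]
  have hc : ∀ i, Set.MapsTo (Module.preReflection (ct i) (p (rt i)))
      (Set.range ct) (Set.range ct) := by
    rintro i _ ⟨j, rfl⟩
    obtain ⟨-, γ, hγ, hγeq⟩ := hRD _ (e.symm i).2 _ (e.symm j).2
    refine ⟨e ⟨γ, hγ⟩, ?_⟩
    simp only [ct, Equiv.symm_apply_apply]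
    rw [Module.preReflection_apply, hp, hγeq, map_corootReflection]
  have hct_inj : Function.Injective ct :=
    injective_of_mapsTo_preReflection p (Set.finite_range rt) hrt_inj hp2 hr
  -- the root pairing
  let P : RootPairing (Fin m) ℤ L L := RootPairing.mk' p ⟨rt, hrt_inj⟩ ⟨ct, hct_inj⟩ hp2 hr hc
  have hP : IsRootDatumOf G T P bX bY :=
    { le := hT.1
      pairing_eq := fun χ γ => hp χ γ
      range_root := hrange
      exists_sl2Hom := fun i => by
        obtain ⟨φ, hφ⟩ := hsl2 _ (e.symm i).2
        have hroot : charOfWeight bX (P.root i) =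
            ((e.symm i : ↥(roots G T)) : ↥(characterLattice T)) := by
          simp [charOfWeight, P, RootPairing.mk', rt]
        have hcoroot : cocharOfCoweight bY (P.coroot i) = (cr (e.symm i : ↥(roots G T)) :
            kˣ →* ↥T) := by
          simp [cocharOfCoweight, P, RootPairing.mk', ct]
        refine ⟨φ, hφ.1, ?_, ?_, ?_⟩
        · rw [hroot]; exact hφ.2.1
        · rw [hroot]; exact hφ.2.2.1
        · intro t; rw [hcoroot]; exact hφ.2.2.2 t }
  exact ⟨Fin m, L, L, inferInstance, inferInstance, inferInstance, P, bX, bY, hP,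
    isReduced_of_isRootDatumOf_of_roots_isReduced hE hG hT hP⟩

/-- **lang.S13 (b) reduced to its structure-theoretic core**: `exists_isRootDatumOf` (Springer
7.4.3: a connected reductive group has a reduced root datum) follows from the two named facts
`exists_sl2Realization` (8.1.4 (i) with 7.2.4, 7.3.3–7.3.5: every root admits an
`SL₂`-realisation) and `roots_isReduced` (7.4.4); the torus theory (3.2.11), the finiteness of
`R`, the coroots, (RD 1), (RD 2) and the injectivity of `α ↦ α^∨` are proved.
[cite: SpringerLAG1998, 7.4.3 with 7.4.4 and 8.1.4 (i)] -/
theorem exists_isRootDatumOf_of_sl2Realization (h1 : exists_sl2Realization (G := G) (T := T))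
    (hE : roots_isReduced (G := G) (T := T)) : exists_isRootDatumOf (G := G) (T := T) :=
  exists_isRootDatumOf_of_corootMap (exists_corootMap_of_sl2Realization h1) hE

end Literature.NumberTheory.Automorphic
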